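import Literature.MathematicalPhysics.QuantumFieldTheory.Balaban1983to89.B1Eq324BenfattoClassSectEMember
import Literature.MathematicalPhysics.QuantumFieldTheory.Balaban1983to89.B9Thm314WholePinGeometry
import Literature.MathematicalPhysics.QuantumFieldTheory.Balaban1983to89.Node00.OpsYOfLetters
import HarnessLib

/-!
# `Balaban1983to89.B1Eq324BenfattoClassSectEMemberAtNode00` — THE (3.24) TORUS DOORS OF SEAT n08-b's `…ClassSectEMember` AT NODE 00's CARRIERS:
# the index presentation (`site`, `lab`, their joint injectivity, the pseudo-distance `ρ` and its coordinate bound) DISCHARGED for the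
# top-level index bonds of a member of def-Y's k-level V1 torus index, in the `|y − y′|` currency of [Balaban1985BackgroundPropagators] Thm 3.15

statement-level companion of published sources with citation tags; every declaration here is a theorem; nothing here is a claim about the
Yang–Mills mass gap

WHY THIS MODULE (cell `pub-ymgap`, seat `dag-n08-d` gen 26, CLAIM-82; node N08 [Balaban1985UV3]; the [BenfattoEtAl1978] source chain behind the
(α)-row `h324`).  Seat n08-b's `…ClassSectEMember` (p645440) states [Balaban1982Higgs1] (3.24) for the Gaussian step measure of [Balaban1985UV3] (3.24)
given EITHER by the Sect.-E precision `T := Cᵀ(P − a·1 − 𝒥)C` of [Balaban1985BackgroundPropagators] (3.156)–(3.158) (`eq324_sectEPrecision_torus_on_unit`)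
OR by a precision `T = C*Δ_kC` with two-sided form bounds whose covariance `T⁻¹ = C̃^{(k)}(Λ)` has the (3.187)-type decay of Thm 3.15
(`eq324_sectECovariance_torus_on_unit`) — on ABSTRACT variables `β` carrying an INDEX PRESENTATION: torus sites `site : β → (ℤ/N)^D`, labels
`lab : β → Fin m` with `(site, lab)` injective, and a pseudo-distance `ρ` dominating the torus coordinate differences
(`|((site b i − site b′ i).valMinAbs)| ≤ ρ b b′`).  THIS FILE supplies that presentation ONCE AND FOR ALL at NODE 00's carriers (def-Y's members
`x : B9PinMembersKLevelV1.MemberY …`, index bonds `Node00.IBondY x.toKIdx`): the variables of the Gaussian integral (3.155) are functions on bonds of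
`Λ ⊂ Λ_k` — *«We assume that Λ ⊂ Λ_k = Ω_k^{(k)} is a union of big blocks»* (p. 427) — i.e. on TOP-LEVEL index bonds (`lvl b = k`; def-Y's `inΛY x b` implies
it, `B9PinGeometryKLevelV1.inΛY_top`), with values in the Lie algebra (finitely many real components, `Fin n`).  For these:
* `site (b, α) := kLab x b mod N_k` — def-Y's `k`-block label of the base point (`B9PinGeometryKLevelV1.kLab`), a point of `T₁^{(k)} = (ℤ/N_k)^{d+1}`,
  `N_k = L·M_h·P′ = sitesPerDir k` (§1);
* `ρ := unitDistY x` on the first coordinate — def-Y's `|y − y′|` on `T₁^{(k)}`, THE distance of Thm 3.15 (3.187) in the tree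
  (`B9Thm315WholeSectERep`), a pseudo-distance (`B9Thm314WholePinGeometry.isPseudoDist_unitDistY`, n06-m) dominated by the Sect.-A distance (2.46) of the
  carrier blocks (`B9Thm314WholePinGeometry.unitDistY_le_dist`) — so rows stated in `(geo9Y x).dist` transfer;
* ★ `abs_valMinAbs_kLab_sub_le_unitDistY` (§2): THE COORDINATE BOUND — for ALL index bonds `b, b′` and every direction `μ`,
  `|((kLab x b μ : ℤ/N_k) − (kLab x b′ μ)).valMinAbs| ≤ unitDistY x b b′` (the `μ`-th coordinate of the sup-distance of the `k`-block centres on the real torus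
  `Π ℝ/N₀ℤ`, rescaled by `L^k`: `AddCircle.norm_eq`);
* ★ `eq_of_top_of_kLab_eq` / ★ `siteCode_injective` (§3): ON TOP-LEVEL INDEX BONDS the triple (`kLab`, the END-BIT «`b₋ ∈ Ω_k^{(k)}`», the direction) determines
  the bond — the end-bit is NECESSARY: the entering bond `⟨x − e_μ, x⟩` (`x − e_μ ∉ Ω_k^{(k)}`) and `⟨x, x + e_μ⟩` are both index bonds ([Balaban1984PropagatorsII]
  (2.3): «at least one end-point in Λ_j») with the same carrier block `B^k(x)` and direction; so `lab (b, α) := ⟨end-bit, dir, α⟩ ∈ Fin (2·(d+1)·n)` and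
  `(site, lab)` is injective on `↥S × Fin n` for every finset `S` of top-level index bonds;
* §4 THE DOORS FIRED: ★★★ `eq324_sectECovariance_node00_on_unit` (Thm 3.15 currency: `T` symmetric with `γ₀ ≤ T ≤ γ₁` as forms and
  `|T⁻¹ (b,α) (b′,α′)| ≤ B₀e^{−δ₀|y_b − y_{b′}|}` ⟹ window, presentation, a.e. box, (3.24) pair — constants `b₁, C` from `(d, n, γ₀, γ₁, B₀, δ₀)` and the
  (3.24) letters ONLY: uniform in the step `k`, the run, the torus, the member, `Λ`, the background) and ★★★ `eq324_sectEPrecision_node00_on_unit` (Sect.-E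
  letter currency: `P`, `𝒥` on all index bonds × components with `e^{−δ|y−y′|}` decay, `|a| ≤ a₀`, `E` local with column mass, `γ₀`-coercivity of
  `Eᵀ(P − a − 𝒥)E`; `υ := IBondY × Fin n`, `ι :=` the inclusion).
What remains displayed is exactly node N06's analytic content (the Sect.-E rows G-B9-09∕Thm 3.15, resp. (3.132)∕(3.36)-type rows of the letters) and the
ℝ-reading of the ℂ-linear letters (`B9CoReadingCoordsTranspose`, n06-d) — the IDENT's member half at a general background is thereby reduced to N06's rows
BY NAME; nothing of it is claimed here.

HONEST SCOPE.  Count-neutral bookkeeping over certified lineages (p21's torus geometry `B6Geom246MultiLevelTorus` ∕ `B9Thm314GpFlatTorusGeometry`, the V1 index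
`B6Ineq2142KLevelV1`, def-Y's pins `B9PinGeometryKLevelV1`, n06-m∕n06-a's `B9Thm314WholePinGeometry`, n08-b's doors); no operator of [Balaban1985BackgroundPropagators]
is constructed or estimated; the tower datum's step measure `(𝔖 k).μ` is NOT pinned here and the IDENT is NOT made; `PrintedUV3V` ∕ row `h324c` NOT discharged;
node N08 NOT discharged; one finite 𝕋^{d+1} programme — nothing about d = 4 specifically, the continuum, OS axioms, a mass gap or the Clay problem.
No `sorry`, no `def`, no `instance`, no `notation`.
-/

noncomputable section

open MeasureTheory Finset Matrix

namespace Literature.MathematicalPhysics.QuantumFieldTheory.Balaban1983to89.B1Eq324BenfattoClassSectEMemberAtNode00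

open Literature.MathematicalPhysics.QuantumFieldTheory
open Literature.MathematicalPhysics.QuantumFieldTheory.Balaban1983to89.B1Eq324BenfattoLemma
  (Coef hamiltonian coefSup smallFieldSet cutoffBoltzmann cumulantSum)
open Literature.MathematicalPhysics.QuantumFieldTheory.Balaban1983to89.B4Sect5Torus (IsPseudoDist)
open Literature.MathematicalPhysics.QuantumFieldTheory.Balaban1983to89.B4TorusKernel.MultiPeriod (circAbs circAbs_nonneg)
open Literature.MathematicalPhysics.QuantumFieldTheory.Balaban1983to89.B4Reflection242 (boxDom mem_boxDom blk)
open Literature.MathematicalPhysics.QuantumFieldTheory.Balaban1983to89.B6MultiLevelBoxOperator (N0)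
open Literature.MathematicalPhysics.QuantumFieldTheory.Balaban1983to89.B6Geom246MultiLevelTorus (toT norm_coe_int)
open Literature.MathematicalPhysics.QuantumFieldTheory.Balaban1983to89.B6SectAOperatorsV1 (BondIdx)
open Literature.MathematicalPhysics.QuantumFieldTheory.Balaban1983to89.B6GlobalChartV1 (PV toBox toBox_apply domT blk_toBox)
open Literature.MathematicalPhysics.QuantumFieldTheory.Balaban1983to89.B6Ineq2142KLevelV1 (lvl lvl_le_mK base baseSite iterBlockOf_baseSite)
open Literature.MathematicalPhysics.QuantumFieldTheory.Balaban1983to89.B5Eq117TorusCarriers (Mk sitesPerDir_zero_eq)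
open Literature.MathematicalPhysics.QuantumFieldTheory.Balaban1983to89.B6LowerBound2153Torus (rep)
open Literature.MathematicalPhysics.QuantumFieldTheory.Balaban1983to89.B9Thm314GpFlatTorusGeometry (tdistK cenLab)
open Literature.MathematicalPhysics.QuantumFieldTheory.Balaban1983to89.B9PinMembersKLevelV1 (MemberY geo9Y)
open Literature.MathematicalPhysics.QuantumFieldTheory.Balaban1983to89.B9PinGeometryKLevelV1 (kLab unitDistY inΛY inΛY_top)
open Literature.MathematicalPhysics.QuantumFieldTheory.Balaban1983to89.B9Thm314WholePinGeometry (unitDistY_le_dist isPseudoDist_unitDistY)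
open Literature.MathematicalPhysics.QuantumFieldTheory.Balaban1983to89.Node00 (IBondY)
open Literature.MathematicalPhysics.QuantumFieldTheory.Balaban1983to89.B1Eq324BenfattoClassSectEMember
  (eq324_sectEPrecision_torus_on_unit eq324_sectECovariance_torus_on_unit)

variable {d ℓ : ℕ} {hd : 1 ≤ d + 1} {hL : Odd (ℓ + 1) ∧ 1 < ℓ + 1} {w₀ w₁ : ℝ} {Mstar : ℕ}

/-! ## §1  The unit lattice `T₁^{(k)} = (ℤ/N_k)^{d+1}` of a member and the range of the `k`-labels -/

/-- **`N_k = L·M_h·P′_μ = sitesPerDir k`**: the period of the unit lattice `T₁^{(k)}` in every direction (the member's torus is cubic: `N₀ = L^k·N_k` is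
`sitesPerDir 0` by `x.hN`, and `sitesPerDir 0 = L^k · sitesPerDir k`). [cite: Balaban1984PropagatorsI, (1.17)–(1.18) p.20; Balaban1984PropagatorsII, (2.1) p.224 (dictionary)] -/
theorem L_mul_Mh_mul_P_eq (x : MemberY d ℓ hd hL w₀ w₁ Mstar) (μ : Fin (d + 1)) :
    (ℓ + 1) * (x.Mh * x.P' μ) = (PV d ℓ x.m x.K hd hL).sitesPerDir x.k := by
  have h1 : (ℓ + 1) ^ x.k * ((ℓ + 1) * (x.Mh * x.P' μ)) = (PV d ℓ x.m x.K hd hL).sitesPerDir 0 := x.hN μ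
  rw [sitesPerDir_zero_eq (P := PV d ℓ x.m x.K hd hL) x.hk] at h1
  exact Nat.eq_of_mul_eq_mul_left (by positivity) h1

/-- the fundamental period: `N₀_μ = L^k · N_k`. [cite: Balaban1984PropagatorsII, (2.1) p.224 (dictionary)] -/
theorem N0_eq_pow_mul_sitesPerDir (x : MemberY d ℓ hd hL w₀ w₁ Mstar) (μ : Fin (d + 1)) :
    N0 ℓ x.Mh x.k x.P' μ = (ℓ + 1) ^ x.k * (PV d ℓ x.m x.K hd hL).sitesPerDir x.k := by
  rw [← L_mul_Mh_mul_P_eq x μ]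

/-- **THE `k`-LABEL LIES IN `[0, N_k)`** in every coordinate (the base point's fine labels lie in `[0, N₀)`, `N₀ = L^k N_k`).
[cite: Balaban1985BackgroundPropagators, (3.187) p.432 («y, y′ ∈ Λ» points of T₁^{(k)}); Balaban1984PropagatorsII, (2.1) p.224 (dictionary)] -/
theorem kLab_nonneg_lt (x : MemberY d ℓ hd hL w₀ w₁ Mstar) (b : IBondY x.toKIdx) (μ : Fin (d + 1)) :
    0 ≤ kLab x b μ ∧ kLab x b μ < ((PV d ℓ x.m x.K hd hL).sitesPerDir x.k : ℤ) := by
  have hz := (mem_boxDom.1 (toBox x.hN (baseSite x.hN x.D x.hk b)).2) μ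
  have hL0 : (0 : ℤ) < (((ℓ + 1) ^ x.k : ℕ) : ℤ) := by positivity
  have hN : ((N0 ℓ x.Mh x.k x.P' μ : ℕ) : ℤ) = (((ℓ + 1) ^ x.k : ℕ) : ℤ) * ((PV d ℓ x.m x.K hd hL).sitesPerDir x.k : ℤ) := by
    rw [N0_eq_pow_mul_sitesPerDir x μ]; push_cast; ring
  unfold kLab
  simp only [blk]
  refine ⟨Int.ediv_nonneg hz.1 (by exact_mod_cast hL0.le), ?_⟩
  refine Int.ediv_lt_of_lt_mul hL0 ?_
  have h2 := hz.2
  rw [hN] at h2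
  push_cast at h2 ⊢
  linarith [mul_comm ((((ℓ : ℤ) + 1) ^ x.k)) (((PV d ℓ x.m x.K hd hL).sitesPerDir x.k : ℤ))]

/-! ## §2  The coordinate bound: `|y_μ − y′_μ|_{ℤ/N_k} ≤ |y − y′|` -/

/-- **ONE COORDINATE OF THE TORUS SUP-DISTANCE**: for label vectors `β, β′ ∈ ℤ^{d+1}` and the torus `Π_μ ℝ/N₀_μℤ` with `N₀_μ = L^k·(L M_h P_μ)`, the circular
distance of the `μ`-th labels modulo `L M_h P_μ` is at most p21's `tdistK β β′` (the sup-distance of the `k`-block centres, in units of `L^k`).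
[cite: Balaban1985BackgroundPropagators, (3.154) p.427, (3.187) p.432 («|y − y′|»); Balaban1983RegularityDecay, p.572 (T_η periodic; dictionary)] -/
theorem circAbs_sub_le_tdistK {Mh k : ℕ} {P : Fin (d + 1) → ℕ} (hMh : 1 ≤ Mh) (hP : ∀ μ, 1 ≤ P μ)
    (β β' : Fin (d + 1) → ℤ) (μ : Fin (d + 1)) :
    ((circAbs ((ℓ + 1) * (Mh * P μ)) (β μ - β' μ) : ℤ) : ℝ) ≤ tdistK (ℓ := ℓ) (Mh := Mh) (k := k) (P := P) β β' := by
  have hLk : (0 : ℝ) < (((ℓ + 1) ^ k : ℕ) : ℝ) := by positivity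
  have hNk1 : 1 ≤ (ℓ + 1) * (Mh * P μ) := Nat.one_le_iff_ne_zero.mpr (by
    have := hP μ; positivity)
  have hNk : (0 : ℝ) < (((ℓ + 1) * (Mh * P μ) : ℕ) : ℝ) := by exact_mod_cast hNk1
  unfold tdistK
  rw [le_div_iff₀ hLk]
  -- the `μ`-th coordinate of the sup-distance of the centres
  refine le_trans ?_ (dist_le_pi_dist (toT (N0 ℓ Mh k P) (cenLab ((ℓ + 1) ^ k) β)) (toT (N0 ℓ Mh k P) (cenLab ((ℓ + 1) ^ k) β')) μ)
  -- compute that coordinate: `‖L^k (β_μ − β′_μ) mod L^k N_k‖ = L^k · ‖(β_μ − β′_μ) mod N_k‖`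
  have hN0 : (((N0 ℓ Mh k P μ : ℕ)) : ℝ) = (((ℓ + 1) ^ k : ℕ) : ℝ) * ((((ℓ + 1) * (Mh * P μ) : ℕ)) : ℝ) := by
    have : N0 ℓ Mh k P μ = (ℓ + 1) ^ k * ((ℓ + 1) * (Mh * P μ)) := rfl
    rw [this]; push_cast; ring
  have hcen : cenLab ((ℓ + 1) ^ k) β μ - cenLab ((ℓ + 1) ^ k) β' μ = (((ℓ + 1) ^ k : ℕ) : ℝ) * (((β μ - β' μ : ℤ)) : ℝ) := by
    simp only [cenLab]; push_cast; ring
  rw [dist_eq_norm]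
  show _ ≤ ‖((cenLab ((ℓ + 1) ^ k) β μ : ℝ) : AddCircle (((N0 ℓ Mh k P μ : ℕ)) : ℝ)) -
    ((cenLab ((ℓ + 1) ^ k) β' μ : ℝ) : AddCircle (((N0 ℓ Mh k P μ : ℕ)) : ℝ))‖
  rw [← AddCircle.coe_sub, AddCircle.norm_eq, hcen, ← norm_coe_int hNk1 (β μ - β' μ), AddCircle.norm_eq]
  -- pure arithmetic: `q⁻¹ (L^k Δ) = N_k⁻¹ Δ` for `q = L^k N_k`
  set Δ : ℝ := (((β μ - β' μ : ℤ)) : ℝ) with hΔ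
  set Lk : ℝ := (((ℓ + 1) ^ k : ℕ) : ℝ) with hLkdef
  set Nk : ℝ := ((((ℓ + 1) * (Mh * P μ) : ℕ)) : ℝ) with hNkdef
  have hq : ((((N0 ℓ Mh k P μ : ℕ)) : ℝ))⁻¹ * (Lk * Δ) = Nk⁻¹ * Δ := by
    rw [hN0]; field_simp
  rw [hq, hN0]
  have h3 : Lk * Δ - (round (Nk⁻¹ * Δ) : ℝ) * (Lk * Nk) = Lk * (Δ - (round (Nk⁻¹ * Δ) : ℝ) * Nk) := by ring
  rw [h3, abs_mul, abs_of_pos hLk, mul_comm]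

/-- ★ **THE COORDINATE BOUND AT A MEMBER, FOR ALL INDEX BONDS**: `|((kLab x b μ : ℤ/N_k) − (kLab x b′ μ : ℤ/N_k)).valMinAbs| ≤ unitDistY x b b′` — the input
`hρ`∕`hρι` of seat n08-b's torus kits (`…ClassTorusWindow.exists_presentation_of_torusDecay`, `…ClassSectEMember.*_torus_on_unit`) at
`site := kLab mod N_k`, `ρ := unitDistY x` (def-Y's `|y − y′|` on `T₁^{(k)}`).
[cite: Balaban1985BackgroundPropagators, Thm 3.15 (3.187) p.432 («|y − y′|, y, y′ ∈ Λ»); Balaban1985UV3, (58) p.270 (dictionary)] -/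
theorem abs_valMinAbs_kLab_sub_le_unitDistY (x : MemberY d ℓ hd hL w₀ w₁ Mstar) (b b' : IBondY x.toKIdx) (μ : Fin (d + 1)) :
    (|((((kLab x b μ : ℤ) : ZMod ((PV d ℓ x.m x.K hd hL).sitesPerDir x.k)) -
        ((kLab x b' μ : ℤ) : ZMod ((PV d ℓ x.m x.K hd hL).sitesPerDir x.k))).valMinAbs : ℤ)| : ℝ) ≤ unitDistY x b b' := by
  set N : ℕ := (PV d ℓ x.m x.K hd hL).sitesPerDir x.k with hNdef
  have hz : (((kLab x b μ : ℤ) : ZMod N) - ((kLab x b' μ : ℤ) : ZMod N)) = ((kLab x b μ - kLab x b' μ : ℤ) : ZMod N) := by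
    push_cast; rfl
  have hnat : (((((kLab x b μ : ℤ) : ZMod N) - ((kLab x b' μ : ℤ) : ZMod N)).valMinAbs.natAbs : ℕ) : ℤ) =
      circAbs N (kLab x b μ - kLab x b' μ) := by
    rw [hz, ZMod.valMinAbs_natAbs_eq_min]
    have hv : ((((kLab x b μ - kLab x b' μ : ℤ) : ZMod N)).val : ℤ) = (kLab x b μ - kLab x b' μ) % (N : ℤ) := ZMod.val_intCast _
    have hle : (((kLab x b μ - kLab x b' μ : ℤ) : ZMod N)).val ≤ N := (ZMod.val_lt _).le
    rw [Nat.cast_min, Nat.cast_sub hle, hv]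
    rfl
  have habs : |((((kLab x b μ : ℤ) : ZMod N) - ((kLab x b' μ : ℤ) : ZMod N)).valMinAbs : ℤ)| = circAbs N (kLab x b μ - kLab x b' μ) := by
    rw [Int.abs_eq_natAbs, hnat]
  rw [← Int.cast_abs, habs, hNdef, ← L_mul_Mh_mul_P_eq x μ]
  exact circAbs_sub_le_tdistK (k := x.k) (B9Thm314WholePinGeometry.one_le_Mh x) (B9Thm314WholePinGeometry.one_le_P x) (kLab x b) (kLab x b') μ

/-- the same bound against the Sect.-A distance (2.46) of the carrier blocks (`unitDistY ≤ (geo9Y x).dist`, n06-a∕n06-m): rows stated in def-Y's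
`B9.SiteKernel (geo9K ·)` currency transfer verbatim. [cite: Balaban1984PropagatorsII, (2.46) p.231; Balaban1985BackgroundPropagators, (3.187) p.432 (dictionary)] -/
theorem abs_valMinAbs_kLab_sub_le_dist9Y (x : MemberY d ℓ hd hL w₀ w₁ Mstar) (b b' : IBondY x.toKIdx) (μ : Fin (d + 1)) :
    (|((((kLab x b μ : ℤ) : ZMod ((PV d ℓ x.m x.K hd hL).sitesPerDir x.k)) -
        ((kLab x b' μ : ℤ) : ZMod ((PV d ℓ x.m x.K hd hL).sitesPerDir x.k))).valMinAbs : ℤ)| : ℝ) ≤ (geo9Y x).dist b b' :=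
  (abs_valMinAbs_kLab_sub_le_unitDistY x b b' μ).trans (unitDistY_le_dist x b b')

/-- the Sect.-A distance (2.46) of the carrier blocks is a pseudo-distance on the index bonds (p21's realised graph distance; (2.54)).
[cite: Balaban1984PropagatorsII, (2.46) p.231, (2.54) p.233] -/
theorem isPseudoDist_dist9Y (x : MemberY d ℓ hd hL w₀ w₁ Mstar) : IsPseudoDist (geo9Y x).dist := by
  have h := B6Geom246MultiLevelTorus.triangle_refl_nonneg_T x.D (B9Thm314WholePinGeometry.one_le_Mh x) (B9Thm314WholePinGeometry.one_le_P x)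
  refine ⟨fun b b' => ?_, fun b => h.2.1 _, fun a b c => h.1 _ _ _⟩
  show (((B6Geom246MultiLevelTorus.bondT x.D).dist _ _ : ℕ) : ℝ) = (((B6Geom246MultiLevelTorus.bondT x.D).dist _ _ : ℕ) : ℝ)
  rw [SimpleGraph.dist_comm]

/-! ## §3  Top-level index bonds are determined by (`k`-label, end-bit, direction) -/

/-- `x ↦ x + e_μ` is injective on a torus level. [folklore] -/
private theorem shift_injective {P : Params} {j : ℕ} (μ : Fin P.d) : Function.Injective fun z : Site P j => z.shift μ := by
  intro z z' h
  funext ν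
  have hν := congrFun h ν
  by_cases hνμ : ν = μ
  · subst hνμ
    simpa [Site.shift] using hν
  · simpa [Site.shift, Function.update_of_ne hνμ] using hν

/-- the integer labels determine the torus point. [folklore] -/
private theorem rep_injective {P : Params} {j : ℕ} {z z' : Site P j} (h : rep (Mk P j) z = rep (Mk P j) z') : z = z' := by
  funext μ
  have hμ : rep (Mk P j) z μ = rep (Mk P j) z' μ := congrFun h μ
  dsimp only [rep] at hμ
  exact ZMod.val_injective _ (by exact_mod_cast hμ)

/-- **FOR A TOP-LEVEL INDEX BOND THE `k`-LABEL IS THE BASE END-POINT**: `kLab x b = (labels of base b)` when `lvl b = k` (the base block of a level-`k` bond is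
the unit cube of its base point). [cite: Balaban1984PropagatorsII, (2.3) p.224, (2.45) p.231 (dictionary)] -/
theorem kLab_eq_rep_base (x : MemberY d ℓ hd hL w₀ w₁ Mstar) (b : IBondY x.toKIdx) (hb : lvl x.hN x.D x.hk b = x.k) :
    kLab x b = rep (Mk (PV d ℓ x.m x.K hd hL) (lvl x.hN x.D x.hk b)) (base x.hN x.D x.hk b) := by
  unfold kLab
  rw [show (ℓ + 1) ^ x.k = (ℓ + 1) ^ lvl x.hN x.D x.hk b from by rw [hb], blk_toBox x.hN (lvl_le_mK x.hN x.D x.hk b),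
    iterBlockOf_baseSite]

/-- ★ **A TOP-LEVEL INDEX BOND IS DETERMINED BY ITS `k`-LABEL, ITS END-BIT AND ITS DIRECTION**: two index bonds of level `k` with the same `kLab`, the same
answer to «`b₋ ∈ Ω_k^{(k)}`?» and the same direction are equal.  (Without the end-bit this fails: `⟨x − e_μ, x⟩` entering `Ω_k^{(k)}` and `⟨x, x + e_μ⟩`
share base point `x` and direction.) [cite: Balaban1984PropagatorsII, (2.3) p.224 («Λ_j also denotes the set of bonds with at least one end-point in Λ_j»), (2.45) p.231] -/
theorem eq_of_top_of_kLab_eq (x : MemberY d ℓ hd hL w₀ w₁ Mstar) {b b' : IBondY x.toKIdx}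
    (hb : lvl x.hN x.D x.hk b = x.k) (hb' : lvl x.hN x.D x.hk b' = x.k) (hlab : kLab x b = kLab x b')
    (hend : (b.1.2.src ∈ (domT x.hN x.D x.hk).Om (lvl x.hN x.D x.hk b) ↔ b'.1.2.src ∈ (domT x.hN x.D x.hk).Om (lvl x.hN x.D x.hk b')))
    (hdir : b.1.2.dir = b'.1.2.dir) : b = b' := by
  obtain ⟨⟨⟨j, hj⟩, c⟩, hc⟩ := b
  obtain ⟨⟨⟨j', hj'⟩, c'⟩, hc'⟩ := b'
  change j = x.k at hb
  change j' = x.k at hb'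
  subst hb
  subst hb'
  -- the base end-points agree
  have hbase : base x.hN x.D x.hk ⟨⟨⟨x.k, hj⟩, c⟩, hc⟩ = base x.hN x.D x.hk ⟨⟨⟨x.k, hj'⟩, c'⟩, hc'⟩ := by
    apply rep_injective
    have h1 := kLab_eq_rep_base x ⟨⟨⟨x.k, hj⟩, c⟩, hc⟩ rfl
    have h2 := kLab_eq_rep_base x ⟨⟨⟨x.k, hj'⟩, c'⟩, hc'⟩ rfl
    exact (h1.symm.trans (hlab.trans h2) : _)
  change c.src ∈ (domT x.hN x.D x.hk).Om x.k ↔ c'.src ∈ (domT x.hN x.D x.hk).Om x.k at hend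
  change c.dir = c'.dir at hdir
  unfold base at hbase
  change (if c.src ∈ (domT x.hN x.D x.hk).Om x.k then c.src else c.tgt) =
    (if c'.src ∈ (domT x.hN x.D x.hk).Om x.k then c'.src else c'.tgt) at hbase
  have hsrc : c.src = c'.src := by
    by_cases h : c.src ∈ (domT x.hN x.D x.hk).Om x.k
    · rw [if_pos h, if_pos (hend.1 h)] at hbase
      exact hbase
    · have h' : c'.src ∉ (domT x.hN x.D x.hk).Om x.k := fun h' => h (hend.2 h')
      rw [if_neg h, if_neg h'] at hbase
      have : c.src.shift c.dir = c'.src.shift c.dir := by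
        have e : c'.tgt = c'.src.shift c.dir := by rw [hdir]; rfl
        exact hbase.trans e
      exact shift_injective c.dir this
  have hcc : c = c' := by
    cases c; cases c'
    simp only at hsrc hdir
    subst hsrc; subst hdir; rfl
  subst hcc
  rfl

/-- ★ **THE INDEX PRESENTATION IS INJECTIVE ON TOP-LEVEL BONDS × COMPONENTS**: for variables `σ × κ` placed on the index bonds by an injective
`ι : σ → IBondY` with top-level values (print's `B̃` on `Λ̃ ⊂ Λ ⊂ Λ_k`, (3.157)) and a finite component index `κ` (a real frame of the fibre), the pair
(`kLab ∘ ι mod N_k`, ⟨end-bit, direction, component⟩-code in `Fin (2·(d+1)·|κ|)`) is injective — the input `hinj` of seat n08-b's torus kits.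
[cite: Balaban1985BackgroundPropagators, (3.155) p.427 («Λ ⊂ Λ_k … a union of big blocks»; the variables are 𝔤-valued bond functions on Λ̃), (3.157) p.428; Balaban1984PropagatorsII, (2.3) p.224] -/
theorem siteCode_injective (x : MemberY d ℓ hd hL w₀ w₁ Mstar) {κ σ : Type} [Fintype κ] (ι : σ → IBondY x.toKIdx)
    (hι : Function.Injective ι) (htop : ∀ s, lvl x.hN x.D x.hk (ι s) = x.k) :
    Function.Injective fun p : σ × κ =>
      ((fun μ : Fin (d + 1) => (((kLab x (ι p.1) μ : ℤ)) : ZMod ((PV d ℓ x.m x.K hd hL).sitesPerDir x.k))),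
        finProdFinEquiv (finProdFinEquiv
          ((if (ι p.1).1.2.src ∈ (domT x.hN x.D x.hk).Om (lvl x.hN x.D x.hk (ι p.1)) then (0 : Fin 2) else 1),
            ((ι p.1).1.2.dir : Fin (d + 1))), Fintype.equivFin κ p.2)) := by
  intro p q h
  simp only [Prod.mk.injEq] at h
  obtain ⟨hsite, hcode⟩ := h
  have hcode' := finProdFinEquiv.injective hcode
  simp only [Prod.mk.injEq] at hcode'
  obtain ⟨hcode'', hα⟩ := hcode'
  have hcode3 := finProdFinEquiv.injective hcode''
  simp only [Prod.mk.injEq] at hcode3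
  obtain ⟨hbit, hdir⟩ := hcode3
  -- the labels agree as integers (both lie in `[0, N_k)`)
  have hlab : kLab x (ι p.1) = kLab x (ι q.1) := by
    funext μ
    have hμ := congrFun hsite μ
    have hp := kLab_nonneg_lt x (ι p.1) μ
    have hq := kLab_nonneg_lt x (ι q.1) μ
    have hmod := (ZMod.intCast_eq_intCast_iff' _ _ _).mp hμ
    rwa [Int.emod_eq_of_lt hp.1 hp.2, Int.emod_eq_of_lt hq.1 hq.2] at hmod
  -- the end-bits agree as propositions
  have hend : ((ι p.1).1.2.src ∈ (domT x.hN x.D x.hk).Om (lvl x.hN x.D x.hk (ι p.1)) ↔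
      (ι q.1).1.2.src ∈ (domT x.hN x.D x.hk).Om (lvl x.hN x.D x.hk (ι q.1))) := by
    by_cases h1 : (ι p.1).1.2.src ∈ (domT x.hN x.D x.hk).Om (lvl x.hN x.D x.hk (ι p.1)) <;>
      by_cases h2 : (ι q.1).1.2.src ∈ (domT x.hN x.D x.hk).Om (lvl x.hN x.D x.hk (ι q.1)) <;>
      simp only [h1, h2, if_true, if_false] at hbit ⊢ <;> exact absurd hbit (by decide)
  have hpq : ι p.1 = ι q.1 := eq_of_top_of_kLab_eq x (htop p.1) (htop q.1) hlab hend hdir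
  exact Prod.ext (hι hpq) ((Fintype.equivFin κ).injective hα)

/-- the finset form: `S` a finset of top-level index bonds, variables `↥S × κ`. [cite: Balaban1985BackgroundPropagators, (3.155)–(3.157) pp.427–428] -/
theorem siteCode_injective_finset (x : MemberY d ℓ hd hL w₀ w₁ Mstar) {κ : Type} [Fintype κ] (S : Finset (IBondY x.toKIdx))
    (hS : ∀ b ∈ S, lvl x.hN x.D x.hk b = x.k) :
    Function.Injective fun p : ↥S × κ =>
      ((fun μ : Fin (d + 1) => (((kLab x (p.1 : IBondY x.toKIdx) μ : ℤ)) : ZMod ((PV d ℓ x.m x.K hd hL).sitesPerDir x.k))),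
        finProdFinEquiv (finProdFinEquiv
          ((if (p.1 : IBondY x.toKIdx).1.2.src ∈ (domT x.hN x.D x.hk).Om (lvl x.hN x.D x.hk (p.1 : IBondY x.toKIdx)) then (0 : Fin 2) else 1),
            ((p.1 : IBondY x.toKIdx).1.2.dir : Fin (d + 1))), Fintype.equivFin κ p.2)) :=
  siteCode_injective x (fun s : ↥S => (s : IBondY x.toKIdx)) Subtype.val_injective fun s => hS _ s.2

/-! ## §4  The doors of `…ClassSectEMember` FIRED at NODE 00's carriers -/

/-- ★★★ **(3.24) FOR `dμ_{C̃^{(k)}(Λ)}` AT NODE 00 FROM NODE N06's THM 3.15 DELIVERABLES IN THEIR OWN CURRENCY** — seat n08-b's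
`…ClassSectEMember.eq324_sectECovariance_torus_on_unit` with the index presentation DISCHARGED.  A finite component index `κ` (a real frame of the
fibre 𝔤 ⊂ M_N(ℂ); `|κ|` enters the constants) and the class scalars `γ₀, γ₁ > 0` (the two-sided form bounds of the Sect.-E precision `T = C*Δ_kC`, p. 428
«lower bound γ₀» ∕ [Balaban1985UV3] p. 271 «γ₁ is an upper bound»), `B₀ ≥ 0`, `δ₀ > 0` (Thm 3.15 (3.187): `|C̃^{(k)}(Λ; y, y′)| ≤ B₀e^{−δ₀|y−y′|}`) and the
(3.24) letters FIRST ⇒ `∃ b₁ ∀ b₀ > b₁ ∃ C ≥ 0` such that for EVERY `η ∈ (0,1]`, EVERY member `x` of def-Y's k-level V1 torus index (any `L`, torus,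
run, step `k`, sequences `{Ω_j}`, `{Ω′_j}`, region `Λ`), EVERY non-empty variable set `σ` placed injectively on TOP-LEVEL index bonds by `ι : σ → IBondY`
(print's `B̃` on `Λ̃ ⊂ Λ ⊂ Λ_k`, (3.157)) and EVERY real symmetric matrix `T` on `σ × κ` with `γ₀‖v‖² ≤ ⟨v,Tv⟩ ≤ γ₁‖v‖²` and
`|T⁻¹ (s,α) (s′,α′)| ≤ B₀ e^{−δ₀ · unitDistY x (ι s) (ι s′)}` (def-Y's `|y − y′|` on `T₁^{(k)}`): a window `Λ_w ⊂ ℤ^{2(d+1)+1}`, a bijection `e : σ × κ ≃ ↥Λ_w`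
with the class road's field `μ_K` (`K` = zero-extended `reindex e e T⁻¹`) PRESENTING `𝒩(0, T⁻¹)` under `z ↦ z ∘ e`, the a.e. identity of the pulled-back
uniform box with `smallFieldSet Λ_w p`, and for all `(s, I ⊇ J, 𝔞)` with `I ≠ ∅`, `J ⊆ Λ_w`, `sup|𝔞| ≤ c·η^σ` the (3.24) pair
`0 < ∫Π_Δχ̂_{I,p(η)}e^{H_J}dμ_K ∧ |log ∫Π_Δχ̂e^{H_J}dμ_K − Σ_{m≤t}𝓔^T(H_J;m)/m!| ≤ C·η^κ·|I|`.  Supplied here: `site := kLab ∘ ι mod N_k`, `lab := ⟨end-bit,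
dir, component⟩` (`siteCode_injective`), `ρ := unitDistY ∘ ι` (`abs_valMinAbs_kLab_sub_le_unitDistY`).  Displayed (N06 ∕ the IDENT; seat n08-b's
`…ClassSectEMemberCoRead` reads them off an operator in frame coordinates): the three rows of `T`.
[cite: Balaban1985BackgroundPropagators, (3.155)–(3.158) pp.427–428, Thm 3.15 (3.187) p.432; Balaban1985UV3, (24) p.261, (58) p.270, p.271; Balaban1982Higgs1,
(3.24) p.616; BenfattoEtAl1978, Lemma (4.5)–(4.7) p.152 (class form; the bent window and the presentation are ours)] -/
theorem eq324_sectECovariance_node00_on_unit (κ : Type) [Fintype κ] [DecidableEq κ] [Nonempty κ] {γ₀ γ₁ B₀ δ₀ : ℝ} (hγ₀ : 0 < γ₀)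
    (hγ₁ : 0 < γ₁) (hB₀ : 0 ≤ B₀) (hδ₀ : 0 < δ₀) (t D : ℕ) {ϰ : ℝ} (hϰ : 0 < ϰ) {p₀ σ' c κ' : ℝ} (hp₀ : 2 / 3 < p₀) (hσ : 0 < σ')
    (hc : 0 ≤ c) (hκ : 0 < κ') (hκσ : κ' < σ' * (t + 1)) :
    ∃ b₁ : ℝ, ∀ b₀ : ℝ, b₁ < b₀ → ∃ C : ℝ, 0 ≤ C ∧ ∀ η : ℝ, 0 < η → η ≤ 1 →
      ∀ {ℓ : ℕ} {hd : 1 ≤ d + 1} {hL : Odd (ℓ + 1) ∧ 1 < ℓ + 1} {w₀ w₁ : ℝ} {Mstar : ℕ} (x : MemberY d ℓ hd hL w₀ w₁ Mstar)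
        {σ : Type} [Fintype σ] [DecidableEq σ] [Nonempty σ] (ι : σ → IBondY x.toKIdx), Function.Injective ι →
        (∀ s, lvl x.hN x.D x.hk (ι s) = x.k) →
      ∀ {T : Matrix (σ × κ) (σ × κ) ℝ}, (∀ p q, T p q = T q p) →
        (∀ v : σ × κ → ℝ, γ₀ * ∑ p, v p ^ 2 ≤ ∑ p, ∑ q, T p q * v p * v q) →
        (∀ v : σ × κ → ℝ, ∑ p, ∑ q, T p q * v p * v q ≤ γ₁ * ∑ p, v p ^ 2) →
        (∀ p q : σ × κ, |(T⁻¹ : Matrix (σ × κ) (σ × κ) ℝ) p q| ≤ B₀ * Real.exp (-(δ₀ * unitDistY x (ι p.1) (ι q.1)))) →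
      ∃ (Λ : Finset (B1Eq324BenfattoLemma.Site (d + 1 + (d + 1) + 1))) (e : σ × κ ≃ ↥Λ),
        ((gaussianFieldOfKernel fun u w => if h : u ∈ Λ ∧ w ∈ Λ then
            (Matrix.reindex e e (T⁻¹ : Matrix (σ × κ) (σ × κ) ℝ) : Matrix ↥Λ ↥Λ ℝ) ⟨u, h.1⟩ ⟨w, h.2⟩ else 0).map
            (fun (z : B1Eq324BenfattoLemma.Site (d + 1 + (d + 1) + 1) → ℝ) (b : σ × κ) =>
              z ((e b : ↥Λ) : B1Eq324BenfattoLemma.Site (d + 1 + (d + 1) + 1))) =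
          gaussianFieldOfKernel fun b b' => (T⁻¹ : Matrix (σ × κ) (σ × κ) ℝ) b b') ∧
        (∀ p : ℝ, 0 ≤ p →
          ((fun (z : B1Eq324BenfattoLemma.Site (d + 1 + (d + 1) + 1) → ℝ) (b : σ × κ) =>
              z ((e b : ↥Λ) : B1Eq324BenfattoLemma.Site (d + 1 + (d + 1) + 1))) ⁻¹'
              {ω : σ × κ → ℝ | ∀ b, |ω b| ≤ p}) =ᵐ[gaussianFieldOfKernel fun u w => if h : u ∈ Λ ∧ w ∈ Λ then
                (Matrix.reindex e e (T⁻¹ : Matrix (σ × κ) (σ × κ) ℝ) : Matrix ↥Λ ↥Λ ℝ) ⟨u, h.1⟩ ⟨w, h.2⟩ else 0]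
            smallFieldSet Λ p) ∧
        ∀ (s : ℕ) (I J : Finset (B1Eq324BenfattoLemma.Site (d + 1 + (d + 1) + 1))) (𝔞 : Coef (d + 1 + (d + 1) + 1)),
          I.Nonempty → J ⊆ I → J ⊆ Λ → coefSup s D 𝔞 J ≤ c * η ^ σ' →
          0 < ∫ z, cutoffBoltzmann (hamiltonian s D ϰ 𝔞 J) I (B10.pFun b₀ p₀ η) z ∂(gaussianFieldOfKernel fun u w => if h : u ∈ Λ ∧ w ∈ Λ then
              (Matrix.reindex e e (T⁻¹ : Matrix (σ × κ) (σ × κ) ℝ) : Matrix ↥Λ ↥Λ ℝ) ⟨u, h.1⟩ ⟨w, h.2⟩ else 0) ∧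
            |Real.log (∫ z, cutoffBoltzmann (hamiltonian s D ϰ 𝔞 J) I (B10.pFun b₀ p₀ η) z ∂(gaussianFieldOfKernel fun u w =>
                if h : u ∈ Λ ∧ w ∈ Λ then (Matrix.reindex e e (T⁻¹ : Matrix (σ × κ) (σ × κ) ℝ) : Matrix ↥Λ ↥Λ ℝ) ⟨u, h.1⟩ ⟨w, h.2⟩
                else 0)) -
              cumulantSum (gaussianFieldOfKernel fun u w => if h : u ∈ Λ ∧ w ∈ Λ then
                  (Matrix.reindex e e (T⁻¹ : Matrix (σ × κ) (σ × κ) ℝ) : Matrix ↥Λ ↥Λ ℝ) ⟨u, h.1⟩ ⟨w, h.2⟩ else 0)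
                (hamiltonian s D ϰ 𝔞 J) t| ≤ C * η ^ κ' * I.card := by
  obtain ⟨b₁, hb₁⟩ := eq324_sectECovariance_torus_on_unit (d := d + 1) (Nat.succ_pos d) (2 * (d + 1) * Fintype.card κ) hγ₀ hγ₁ hB₀ hδ₀
    t D hϰ hp₀ hσ hc hκ hκσ
  refine ⟨b₁, fun b₀ hb₀ => ?_⟩
  obtain ⟨C, hC, hE⟩ := hb₁ b₀ hb₀
  refine ⟨C, hC, ?_⟩
  intro η hη hηle ℓ hd hL w₀ w₁ Mstar x σ _ _ _ ι hι htop T hTs hlow hup hdec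
  exact hE η hη hηle (N := (PV d ℓ x.m x.K hd hL).sitesPerDir x.k) (β := σ × κ)
    (fun (p : σ × κ) (μ : Fin (d + 1)) => (((kLab x (ι p.1) μ : ℤ)) : ZMod ((PV d ℓ x.m x.K hd hL).sitesPerDir x.k)))
    (fun (p : σ × κ) => finProdFinEquiv (finProdFinEquiv
      ((if (ι p.1).1.2.src ∈ (domT x.hN x.D x.hk).Om (lvl x.hN x.D x.hk (ι p.1)) then (0 : Fin 2) else 1),
        ((ι p.1).1.2.dir : Fin (d + 1))), Fintype.equivFin κ p.2))
    (siteCode_injective x ι hι htop) (T := T) (ρ := fun (p q : σ × κ) => unitDistY x (ι p.1) (ι q.1))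
    hTs hlow hup hdec
    (fun (p q : σ × κ) (μ : Fin (d + 1)) => abs_valMinAbs_kLab_sub_le_unitDistY x (ι p.1) (ι q.1) μ)

/-- ★★★ **(3.24) FOR THE SECT.-E PRECISION `Cᵀ(P − a·1 − 𝒥)C` AT NODE 00, LETTER CURRENCY** — seat n08-b's
`…ClassSectEMember.eq324_sectEPrecision_torus_on_unit` with `(υ, ρ, β, site, lab, ι)` := (`IBondY × κ`, `unitDistY` on the bond coordinate, `σ × κ`,
`kLab ∘ ι mod N_k`, ⟨end-bit, dir, component⟩, `ι × id`) DISCHARGED (`isPseudoDist_unitDistY` (n06-m), `siteCode_injective`,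
`abs_valMinAbs_kLab_sub_le_unitDistY`).  The component index `κ`, the class scalars `γ₀ > 0`, `K_P, K_𝒥 ≥ 0`, `a₀ ≥ 0`, `δ > 0`, `r`, `m_C ≥ 0` and the
(3.24) letters FIRST ⇒ `∃ b₁ ∀ b₀ > b₁ ∃ C ≥ 0` such that for EVERY `η ∈ (0,1]`, member `x`, non-empty variable set `σ` placed injectively on top-level
index bonds by `ι` and EVERY real data: `P`, `𝒥` symmetric on (index bonds × components) with `|P u v|, |𝒥 u v| ≤ K e^{−δ|y_u − y_v|}` ((3.132)∕(3.156) rows),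
`|a| ≤ a₀`, a matrix `E` (the parametrisation `C` of (3.157)) with `E u b ≠ 0 ⇒ |y_u − y_{ι b}| ≤ r` and column mass `Σ_u |E u b| ≤ m_C`, and the
`γ₀`-coercivity of `T := Eᵀ(P − a·1 − 𝒥)E` (p. 428, G-B9-09): a window `Λ_w ⊂ ℤ^{2(d+1)+1}`, `e : σ × κ ≃ ↥Λ_w` presenting `𝒩(0, T⁻¹)`, the a.e. box
identity and the (3.24) pair for every `(s, I ⊇ J, 𝔞)` as above.  Displayed (N06 ∕ the IDENT): the rows of `P`, `𝒥`, `a`, `E` and the coercivity; the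
ℝ-reading of the ℂ-letters (n06-d `B9CoReadingCoordsTranspose`, n08-b `…ClassSectEMemberCoRead`).
[cite: Balaban1985BackgroundPropagators, (3.155)–(3.158) pp.427–428, (3.132) p.422; Balaban1985UV3, (24) p.261, (58) p.270; Balaban1982Higgs1, (3.24) p.616;
BenfattoEtAl1978, Lemma (4.5)–(4.7) p.152 (class form; the bent window and the presentation are ours)] -/
theorem eq324_sectEPrecision_node00_on_unit (κ : Type) [Fintype κ] [DecidableEq κ] [Nonempty κ] {γ₀ KP KJ a₀ δ r mC : ℝ}
    (hγ₀ : 0 < γ₀) (hKP : 0 ≤ KP) (hKJ : 0 ≤ KJ) (ha₀ : 0 ≤ a₀) (hδ : 0 < δ) (hmC : 0 ≤ mC) (t D : ℕ) {ϰ : ℝ} (hϰ : 0 < ϰ)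
    {p₀ σ' c κ' : ℝ} (hp₀ : 2 / 3 < p₀) (hσ : 0 < σ') (hc : 0 ≤ c) (hκ : 0 < κ') (hκσ : κ' < σ' * (t + 1)) :
    ∃ b₁ : ℝ, ∀ b₀ : ℝ, b₁ < b₀ → ∃ C : ℝ, 0 ≤ C ∧ ∀ η : ℝ, 0 < η → η ≤ 1 →
      ∀ {ℓ : ℕ} {hd : 1 ≤ d + 1} {hL : Odd (ℓ + 1) ∧ 1 < ℓ + 1} {w₀ w₁ : ℝ} {Mstar : ℕ} (x : MemberY d ℓ hd hL w₀ w₁ Mstar)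
        [DecidableEq (IBondY x.toKIdx)] {σ : Type} [Fintype σ] [DecidableEq σ] [Nonempty σ] (ι : σ → IBondY x.toKIdx),
        Function.Injective ι → (∀ s, lvl x.hN x.D x.hk (ι s) = x.k) →
      ∀ {P J : Matrix (IBondY x.toKIdx × κ) (IBondY x.toKIdx × κ) ℝ} {a : ℝ} {E : Matrix (IBondY x.toKIdx × κ) (σ × κ) ℝ},
        (∀ u v, P u v = P v u) → (∀ u v, J u v = J v u) →
        (∀ u v : IBondY x.toKIdx × κ, |P u v| ≤ KP * Real.exp (-(δ * unitDistY x u.1 v.1))) →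
        (∀ u v : IBondY x.toKIdx × κ, |J u v| ≤ KJ * Real.exp (-(δ * unitDistY x u.1 v.1))) → |a| ≤ a₀ →
        (∀ (u : IBondY x.toKIdx × κ) (b : σ × κ), E u b ≠ 0 → unitDistY x u.1 (ι b.1) ≤ r) →
        (∀ b : σ × κ, ∑ u, |E u b| ≤ mC) →
        (∀ v : σ × κ → ℝ, γ₀ * ∑ b, v b ^ 2 ≤
          ∑ b, ∑ b', (Eᵀ * (P - a • (1 : Matrix (IBondY x.toKIdx × κ) (IBondY x.toKIdx × κ) ℝ) - J) * E) b b' * v b * v b') →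
      ∃ (Λ : Finset (B1Eq324BenfattoLemma.Site (d + 1 + (d + 1) + 1))) (e : σ × κ ≃ ↥Λ),
        ((gaussianFieldOfKernel fun u w => if h : u ∈ Λ ∧ w ∈ Λ then
            ((Matrix.reindex e e (Eᵀ * (P - a • (1 : Matrix (IBondY x.toKIdx × κ) (IBondY x.toKIdx × κ) ℝ) - J) * E))⁻¹ :
              Matrix ↥Λ ↥Λ ℝ) ⟨u, h.1⟩ ⟨w, h.2⟩ else 0).map
            (fun (z : B1Eq324BenfattoLemma.Site (d + 1 + (d + 1) + 1) → ℝ) (b : σ × κ) =>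
              z ((e b : ↥Λ) : B1Eq324BenfattoLemma.Site (d + 1 + (d + 1) + 1))) =
          gaussianFieldOfKernel fun b b' =>
            ((Eᵀ * (P - a • (1 : Matrix (IBondY x.toKIdx × κ) (IBondY x.toKIdx × κ) ℝ) - J) * E)⁻¹ : Matrix (σ × κ) (σ × κ) ℝ) b b') ∧
        (∀ p : ℝ, 0 ≤ p →
          ((fun (z : B1Eq324BenfattoLemma.Site (d + 1 + (d + 1) + 1) → ℝ) (b : σ × κ) =>
              z ((e b : ↥Λ) : B1Eq324BenfattoLemma.Site (d + 1 + (d + 1) + 1))) ⁻¹'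
              {ω : σ × κ → ℝ | ∀ b, |ω b| ≤ p}) =ᵐ[gaussianFieldOfKernel fun u w => if h : u ∈ Λ ∧ w ∈ Λ then
                ((Matrix.reindex e e (Eᵀ * (P - a • (1 : Matrix (IBondY x.toKIdx × κ) (IBondY x.toKIdx × κ) ℝ) - J) * E))⁻¹ :
                  Matrix ↥Λ ↥Λ ℝ) ⟨u, h.1⟩ ⟨w, h.2⟩ else 0]
            smallFieldSet Λ p) ∧
        ∀ (s : ℕ) (I J' : Finset (B1Eq324BenfattoLemma.Site (d + 1 + (d + 1) + 1))) (𝔞 : Coef (d + 1 + (d + 1) + 1)),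
          I.Nonempty → J' ⊆ I → J' ⊆ Λ → coefSup s D 𝔞 J' ≤ c * η ^ σ' →
          0 < ∫ z, cutoffBoltzmann (hamiltonian s D ϰ 𝔞 J') I (B10.pFun b₀ p₀ η) z ∂(gaussianFieldOfKernel fun u w => if h : u ∈ Λ ∧ w ∈ Λ then
              ((Matrix.reindex e e (Eᵀ * (P - a • (1 : Matrix (IBondY x.toKIdx × κ) (IBondY x.toKIdx × κ) ℝ) - J) * E))⁻¹ :
                Matrix ↥Λ ↥Λ ℝ) ⟨u, h.1⟩ ⟨w, h.2⟩ else 0) ∧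
            |Real.log (∫ z, cutoffBoltzmann (hamiltonian s D ϰ 𝔞 J') I (B10.pFun b₀ p₀ η) z ∂(gaussianFieldOfKernel fun u w =>
                if h : u ∈ Λ ∧ w ∈ Λ then
                  ((Matrix.reindex e e (Eᵀ * (P - a • (1 : Matrix (IBondY x.toKIdx × κ) (IBondY x.toKIdx × κ) ℝ) - J) * E))⁻¹ :
                    Matrix ↥Λ ↥Λ ℝ) ⟨u, h.1⟩ ⟨w, h.2⟩ else 0)) -
              cumulantSum (gaussianFieldOfKernel fun u w => if h : u ∈ Λ ∧ w ∈ Λ then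
                  ((Matrix.reindex e e (Eᵀ * (P - a • (1 : Matrix (IBondY x.toKIdx × κ) (IBondY x.toKIdx × κ) ℝ) - J) * E))⁻¹ :
                    Matrix ↥Λ ↥Λ ℝ) ⟨u, h.1⟩ ⟨w, h.2⟩ else 0)
                (hamiltonian s D ϰ 𝔞 J') t| ≤ C * η ^ κ' * I.card := by
  obtain ⟨b₁, hb₁⟩ := eq324_sectEPrecision_torus_on_unit (d := d + 1) (Nat.succ_pos d) (2 * (d + 1) * Fintype.card κ) hγ₀ hKP hKJ
    ha₀ hδ hmC t D hϰ hp₀ hσ hc hκ hκσ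
  refine ⟨b₁, fun b₀ hb₀ => ?_⟩
  obtain ⟨C, hC, hE⟩ := hb₁ b₀ hb₀
  refine ⟨C, hC, ?_⟩
  intro η hη hηle ℓ hd hL w₀ w₁ Mstar x _ σ _ _ _ ι hι htop P J a E hPs hJs hP hJ ha hCr hC1 hγ
  have hρ : IsPseudoDist fun u v : IBondY x.toKIdx × κ => unitDistY x u.1 v.1 :=
    ⟨fun u v => (isPseudoDist_unitDistY x).symm _ _, fun u => (isPseudoDist_unitDistY x).zero _,
      fun u v w => (isPseudoDist_unitDistY x).triangle _ _ _⟩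
  exact hE η hη hηle (N := (PV d ℓ x.m x.K hd hL).sitesPerDir x.k) (υ := IBondY x.toKIdx × κ) (β := σ × κ)
    (fun u v : IBondY x.toKIdx × κ => unitDistY x u.1 v.1) hρ
    (fun (p : σ × κ) (μ : Fin (d + 1)) => (((kLab x (ι p.1) μ : ℤ)) : ZMod ((PV d ℓ x.m x.K hd hL).sitesPerDir x.k)))
    (fun (p : σ × κ) => finProdFinEquiv (finProdFinEquiv
      ((if (ι p.1).1.2.src ∈ (domT x.hN x.D x.hk).Om (lvl x.hN x.D x.hk (ι p.1)) then (0 : Fin 2) else 1),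
        ((ι p.1).1.2.dir : Fin (d + 1))), Fintype.equivFin κ p.2))
    (siteCode_injective x ι hι htop) (fun b : σ × κ => (ι b.1, b.2))
    (fun (p q : σ × κ) (μ : Fin (d + 1)) => abs_valMinAbs_kLab_sub_le_unitDistY x (ι p.1) (ι q.1) μ)
    (P := P) (J := J) (a := a) (E := E) hPs hJs hP hJ ha hCr hC1 hγ

end Literature.MathematicalPhysics.QuantumFieldTheory.Balaban1983to89.B1Eq324BenfattoClassSectEMemberAtNode00
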